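import Summits.HodgeConjecture.HodgeConjecture.Theorems.F0P6bWeilCartierDualityHead   -- ★ PART A of the same Lines workfile (size-lint split; same namespace `Summit.HodgeConjecture.HodgeConjecture.Cruxes.HLiu418.F0P6bWeilCartierDuality`)
import HarnessLib

/-!
# ★ RE-HOME — PART C of 3 (size lint: `Theorems/` files with proofs are ≤ 400 lines) of `Lines/F0_P6b_WeilCartierDuality.lean` ED. 4: Part A = `Theorems/F0P6bWeilCartierDualityLetters.lean` (§0–§2), Part B = `Theorems/F0P6bWeilCartierDualityHead.lean` (§3–§4, imported), this = §5–§6 (`e₀`, the (iso) law).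

Same namespace `Summit.HodgeConjecture.HodgeConjecture.Cruxes.HLiu418.F0P6bWeilCartierDuality` (every fully-qualified name unchanged); the preamble (options, `noncomputable section`, top-level `open`s) is
repeated verbatim from Part A∕B; the code below is the remainder of the tree bytes, untouched.  See Part A for the ★ re-home header and the original module
docstring.  HC_CM is proved only modulo the 7 printed citations (2 remaining: hLiu418 = stmt-HodgeConjecture-24832, h413 = stmt-HodgeConjecture-24833) until rung 0 closes.
-/


set_option autoImplicit false
set_option linter.dupNamespace false

-- Mathlib's `Over`/`Scheme` APIs are stated across semireducible wrappers (as in the ★ `GroupSchemes/*` files imported here).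
set_option backward.isDefEq.respectTransparency false

noncomputable section

universe u

open CategoryTheory CategoryTheory.Limits AlgebraicGeometry MonoidalCategory CartesianMonoidalCategory
open scoped MonObj
open Literature.AlgebraicGeometry.GroupSchemes Literature.AlgebraicGeometry.GroupSchemes.GroupSchemeKernel
open Literature.AlgebraicGeometry.GroupSchemes.AffineGroupScheme
open Literature.AlgebraicGeometry.Motives Literature.AlgebraicGeometry.Motives.AbelianVariety
open Literature.AlgebraicGeometry.AbelianSchemes Literature.AlgebraicGeometry.AbelianSchemes.AbelianSchemeOver
open Literature.AlgebraicGeometry.AbelianSchemes.AbelianSchemeOver.DualPair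


namespace Summit.HodgeConjecture.HodgeConjecture.Cruxes.HLiu418.F0P6bWeilCartierDuality

/-! ## §5 (P1′ ∕ M-17v′) THE NAMED DUALITY `e₀ := ℓ ≫ w_A` — over the (W1) family, for ANY realisation `ĵ : Ĝ ↪ Â` of `Â[q]`; its EXPORTED
EQUATION `e₀_hom_eq`, and the three head properties AT `e₀` (`weilCartierDualityLagrangian_at`), so that the RGD-facing junction and the (iso)
law of §6 speak about THE SAME term.  (The head `WeilCartierDualityLagrangian` keeps its `∃ e₀` form, ED. 1 tokens.) -/

section Lift

variable {k : Type u} [Field k] (p : ℕ) [ExpChar k p] (r : ℕ) (A : AbelianVariety k) (D : (AbelianScheme.ofAbelianVariety A).toOver.DualPair)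
  (pol : (AbelianScheme.ofAbelianVariety A).toOver.Polarization D) {G : SchemeOver k} [GrpObj G] (j : G ⟶ A.X)
  (hG : ∀ ⦃T : SchemeOver k⦄ (t : T ⟶ A.X), (∃ s : T ⟶ G, s ≫ j = t) ↔ t ≫ ((((p ^ r : ℕ) : ℤ) • 𝟙 A).hom.hom.hom) = 1)
  {Ĝ : SchemeOver k} (ĵ : Ĝ ⟶ D.hat.X)
  (hĜ : ∀ ⦃T : SchemeOver k⦄ (t : T ⟶ D.hat.X),
    (∃ s : T ⟶ Ĝ, s ≫ ĵ = t) ↔ t ≫ ((((p ^ r : ℕ) : ℤ) • 𝟙 D.hat.toAffine.toAbelianVariety).hom.hom.hom) = 1)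

/-- **The lift `ℓ : G → Ĝ` of `λ|_{A[q]}`** (chosen, ★ `exists_lift_lam`): for realisations `j : G ↪ A` of `A[q]` and `ĵ : Ĝ ↪ Â` of `Â[q]`.
[cite: MumfordAV1970, §20 p. 186] -/
def liftLam : G ⟶ Ĝ := Classical.choose (exists_lift_lam p r A D pol j hG ĵ hĜ)

/-- `ℓ ≫ ĵ = j ≫ λ`. [cite: MumfordAV1970, §20 p. 186] -/
theorem liftLam_comp : liftLam p r A D pol j hG ĵ hĜ ≫ ĵ = j ≫ pol.lam :=
  Classical.choose_spec (exists_lift_lam p r A D pol j hG ĵ hĜ)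

end Lift

section Named

variable {k : Type u} [Field k] [PerfectField k] (p : ℕ) [Fact p.Prime] [CharP k p] (r : ℕ)

/-- **THE natural Weil family at level `q = p^r` over `k`** — the (W1) family, RE-POINTED (ED. 4) at the ★ CANONICAL Weil isomorphism: at a
NORMALISED dual pair `D` the witness of ★ `WeilPairing.exists_weilIso'` (fed ★ `DualPair.dim_hat_eq A D`), at a general `D` the same for ★ `D.normalize`
— the very family `stub_W1` exhibits; so its pairing values on finite points ARE the Weil characters `e_q(x ≫ j, y ≫ ĵ)` (`cartierPairing_theFamily_eq_weilChar`
below).  Statement shapes unchanged. [cite: MumfordAV1970, §15 Thm. 1 (p. 143), §20 p. 186] -/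
def theFamily : WeilFamily k p r := fun A D G _ _ _ _ _ j _ _ hG Ĝ _ _ _ _ _ ĵ _ _ hĜ => by
  classical
  exact if hD : Nonempty ((Scheme.Modules.pullback D.unitHatSlice).obj D.P ≅ SheafOfModules.unit _) then
      Classical.choose (Literature.AlgebraicGeometry.AbelianSchemes.WeilPairing.exists_weilIso' p r A D hD (DualPair.dim_hat_eq A D) G j hG Ĝ ĵ hĜ)
    else
      Classical.choose (Literature.AlgebraicGeometry.AbelianSchemes.WeilPairing.exists_weilIso' p r A D.normalize
        D.nonempty_unitHatSlice_iso_normalize (DualPair.dim_hat_eq A D) G j hG Ĝ ĵ hĜ)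

omit [PerfectField k] in
/-- **UNFOLDING at a normalised dual pair** (ED. 4): `theFamily` IS the ★ Weil isomorphism chosen at `D`. [cite: MumfordAV1970, §20 p. 186] -/
theorem theFamily_eq_of_unit (A : AbelianVariety k) (D : (AbelianScheme.ofAbelianVariety A).toOver.DualPair)
    (hD : Nonempty ((Scheme.Modules.pullback D.unitHatSlice).obj D.P ≅ SheafOfModules.unit _))
    (G : SchemeOver k) [GrpObj G] [IsCommMonObj G] [IsAffine G.left] [Module.Free k (Alg G)] [Module.Finite k (Alg G)]
    (j : G ⟶ A.X) [IsMonHom j] [IsClosedImmersion j.left]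
    (hG : ∀ ⦃T : SchemeOver k⦄ (t : T ⟶ A.X), (∃ s : T ⟶ G, s ≫ j = t) ↔ t ≫ ((((p ^ r : ℕ) : ℤ) • 𝟙 A).hom.hom.hom) = 1)
    (Ĝ : SchemeOver k) [GrpObj Ĝ] [IsCommMonObj Ĝ] [IsAffine Ĝ.left] [Module.Free k (Alg Ĝ)] [Module.Finite k (Alg Ĝ)]
    (ĵ : Ĝ ⟶ D.hat.X) [IsMonHom ĵ] [IsClosedImmersion ĵ.left]
    (hĜ : ∀ ⦃T : SchemeOver k⦄ (t : T ⟶ D.hat.X),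
      (∃ s : T ⟶ Ĝ, s ≫ ĵ = t) ↔ t ≫ ((((p ^ r : ℕ) : ℤ) • 𝟙 D.hat.toAffine.toAbelianVariety).hom.hom.hom) = 1) :
    theFamily p r A D G j hG Ĝ ĵ hĜ =
      Classical.choose (Literature.AlgebraicGeometry.AbelianSchemes.WeilPairing.exists_weilIso' p r A D hD (DualPair.dim_hat_eq A D) G j hG Ĝ ĵ hĜ) := by
  simp only [theFamily, dif_pos hD]

omit [PerfectField k] in
/-- **THE READING (ED. 4): the family՚s pairing values on finite points are the Weil characters** — for a NORMALISED dual pair `D` and finite points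
`y` of `Ĝ`, `x` of `G`: `⟪y ≫ w_A, x⟫ = e_q(x ≫ j, y ≫ ĵ)` (★ `cartierPairing`, ★ `DualPair.weilChar`; the `_spec` of ★ `WeilPairing.exists_weilIso'`).  This is the
dictionary through which pairing statements about `e₀ = ℓ ≫ w_A` (isotropy of isogeny kernels, ★ `WeilUnitKernelIsotropicOfDescent`; level shifts) are read.
[cite: MumfordAV1970, §15 Thm. 1 (p. 143), §20 (pp. 184–186)] -/
theorem cartierPairing_theFamily_eq_weilChar (A : AbelianVariety k) (D : (AbelianScheme.ofAbelianVariety A).toOver.DualPair)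
    (hD : Nonempty ((Scheme.Modules.pullback D.unitHatSlice).obj D.P ≅ SheafOfModules.unit _))
    (G : SchemeOver k) [GrpObj G] [IsCommMonObj G] [IsAffine G.left] [Module.Free k (Alg G)] [Module.Finite k (Alg G)]
    (j : G ⟶ A.X) [IsMonHom j] [IsClosedImmersion j.left]
    (hG : ∀ ⦃T : SchemeOver k⦄ (t : T ⟶ A.X), (∃ s : T ⟶ G, s ≫ j = t) ↔ t ≫ ((((p ^ r : ℕ) : ℤ) • 𝟙 A).hom.hom.hom) = 1)
    (Ĝ : SchemeOver k) [GrpObj Ĝ] [IsCommMonObj Ĝ] [IsAffine Ĝ.left] [Module.Free k (Alg Ĝ)] [Module.Finite k (Alg Ĝ)]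
    (ĵ : Ĝ ⟶ D.hat.X) [IsMonHom ĵ] [IsClosedImmersion ĵ.left]
    (hĜ : ∀ ⦃T : SchemeOver k⦄ (t : T ⟶ D.hat.X),
      (∃ s : T ⟶ Ĝ, s ≫ ĵ = t) ↔ t ≫ ((((p ^ r : ℕ) : ℤ) • 𝟙 D.hat.toAffine.toAbelianVariety).hom.hom.hom) = 1)
    ⦃T : Type u⦄ [CommRing T] [Algebra k T] [Module.Finite k T] (y : specOver k T ⟶ Ĝ) (x : specOver k T ⟶ G) :
    cartierPairing G (y ≫ (theFamily p r A D G j hG Ĝ ĵ hĜ).hom) x =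
      D.weilChar hD (p ^ r) (y ≫ ĵ) (Literature.AlgebraicGeometry.AbelianSchemes.WeilPairing.comp_pow_eq_one' (p ^ r) A D Ĝ ĵ hĜ y) (x ≫ j)
        (Literature.AlgebraicGeometry.AbelianSchemes.WeilPairing.comp_pow_eq_one (p ^ r) A G j hG x) := by
  rw [theFamily_eq_of_unit p r A D hD G j hG Ĝ ĵ hĜ]
  exact (Classical.choose_spec (Literature.AlgebraicGeometry.AbelianSchemes.WeilPairing.exists_weilIso' p r A D hD (DualPair.dim_hat_eq A D) G j hG
    Ĝ ĵ hĜ)).2 y x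

omit [PerfectField k] in
/-- The (W1) family is NATURAL (ED. 4: the two clauses of `stub_W1`՚s witness, ★ `WeilPairing.exists_weilIso'` `.1` and ★ `WeilPairing.weilHom_natural`).
[cite: MumfordAV1970, §20 p. 186] -/
theorem theFamily_isNatural : (theFamily (k := k) p r).IsNatural := by
  classical
  refine ⟨?_, ?_⟩
  · intro A D G _ _ _ _ _ j _ _ hG Ĝ _ _ _ _ _ ĵ _ _ hĜ
    by_cases hD : Nonempty ((Scheme.Modules.pullback D.unitHatSlice).obj D.P ≅ SheafOfModules.unit _)
    · simp only [theFamily, dif_pos hD]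
      exact (Classical.choose_spec (Literature.AlgebraicGeometry.AbelianSchemes.WeilPairing.exists_weilIso' p r A D hD (DualPair.dim_hat_eq A D) G j hG
        Ĝ ĵ hĜ)).1
    · simp only [theFamily, dif_neg hD]
      exact (Classical.choose_spec (Literature.AlgebraicGeometry.AbelianSchemes.WeilPairing.exists_weilIso' p r A D.normalize
        D.nonempty_unitHatSlice_iso_normalize (DualPair.dim_hat_eq A D) G j hG Ĝ ĵ hĜ)).1
  · intro A B DA DB hDA hDB f GA _ _ _ _ _ jA _ _ hGA ĜA _ _ _ _ _ ĵA _ _ hĜA GB _ _ _ _ _ jB _ _ hGB ĜB _ _ _ _ _ ĵB _ _ hĜB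
      β _ hβ βd hβd
    simp only [theFamily, dif_pos hDA, dif_pos hDB]
    exact Literature.AlgebraicGeometry.AbelianSchemes.WeilPairing.weilHom_natural (p ^ r) A B DA DB hDA hDB f GA jA hGA ĜA ĵA hĜA GB jB hGB
      ĜB ĵB hĜB β hβ βd hβd _
      (Classical.choose_spec (Literature.AlgebraicGeometry.AbelianSchemes.WeilPairing.exists_weilIso' p r A DA hDA (DualPair.dim_hat_eq A DA) GA jA hGA
        ĜA ĵA hĜA)).2 _
      (Classical.choose_spec (Literature.AlgebraicGeometry.AbelianSchemes.WeilPairing.exists_weilIso' p r B DB hDB (DualPair.dim_hat_eq B DB) GB jB hGB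
        ĜB ĵB hĜB)).2

/-- The (W1) family ANNIHILATES FROBENIUS KERNELS ((W2) at the family). [cite: Oda1969, Cor. 1.3] -/
theorem theFamily_frobeniusAnnihilates : (theFamily (k := k) p r).FrobeniusAnnihilates :=
  stub_W2 p r (theFamily p r) (theFamily_isNatural p r)

variable (A : AbelianVariety k) (D : (AbelianScheme.ofAbelianVariety A).toOver.DualPair)
  (pol : (AbelianScheme.ofAbelianVariety A).toOver.Polarization D)
  {G : SchemeOver k} [GrpObj G] [IsCommMonObj G] [IsAffine G.left] [Module.Free k (Alg G)] [Module.Finite k (Alg G)]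
  (j : G ⟶ A.X) [IsMonHom j] [IsClosedImmersion j.left]
  (hG : ∀ ⦃T : SchemeOver k⦄ (t : T ⟶ A.X), (∃ s : T ⟶ G, s ≫ j = t) ↔ t ≫ ((((p ^ r : ℕ) : ℤ) • 𝟙 A).hom.hom.hom) = 1)
  {Ĝ : SchemeOver k} [GrpObj Ĝ] [IsCommMonObj Ĝ] [IsAffine Ĝ.left] [Module.Free k (Alg Ĝ)] [Module.Finite k (Alg Ĝ)]
  (ĵ : Ĝ ⟶ D.hat.X) [IsMonHom ĵ] [IsClosedImmersion ĵ.left]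
  (hĜ : ∀ ⦃T : SchemeOver k⦄ (t : T ⟶ D.hat.X),
    (∃ s : T ⟶ Ĝ, s ≫ ĵ = t) ↔ t ≫ ((((p ^ r : ℕ) : ℤ) • 𝟙 D.hat.toAffine.toAbelianVariety).hom.hom.hom) = 1)

/-- **THE NAMED DUALITY `e₀ := ℓ ≫ w_A : G ≅ G^D`** (`ℓ` an isomorphism by `hlam` and ranks, ★ `isIso_lift`; `w_A` the (W1) family at
`(A, D, G, Ĝ)`). [cite: MumfordAV1970, §20 (I) (p. 189)] -/
def e₀
    (hlam : ∀ ⦃T : SchemeOver k⦄ (t : T ⟶ G), (t ≫ j) ≫ pol.lam = 1 → t = 1) : G ≅ cartierDual G :=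
  haveI := isIso_lift pol hlam (liftLam p r A D pol j hG ĵ hĜ) (liftLam_comp p r A D pol j hG ĵ hĜ) (theFamily p r A D G j hG Ĝ ĵ hĜ)
  asIso (liftLam p r A D pol j hG ĵ hĜ) ≪≫ theFamily p r A D G j hG Ĝ ĵ hĜ

omit [PerfectField k] in
/-- **EXPORTED EQUATION: `e₀.hom = ℓ ≫ w_A.hom`** (definitional). [cite: MumfordAV1970, §20 (I) (p. 189)] -/
theorem e₀_hom_eq
    (hlam : ∀ ⦃T : SchemeOver k⦄ (t : T ⟶ G), (t ≫ j) ≫ pol.lam = 1 → t = 1) :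
    (e₀ p r A D pol j hG ĵ hĜ hlam).hom = liftLam p r A D pol j hG ĵ hĜ ≫ (theFamily p r A D G j hG Ĝ ĵ hĜ).hom :=
  rfl

omit [PerfectField k] [Fact p.Prime] [CharP k p] [IsMonHom j] [IsClosedImmersion j.left] [GrpObj Ĝ] [IsCommMonObj Ĝ] [IsAffine Ĝ.left]
  [Module.Free k (Alg Ĝ)] [Module.Finite k (Alg Ĝ)] [IsMonHom ĵ] [IsClosedImmersion ĵ.left] in
/-- **THE DICTIONARY (ED. 4): a character of a Weil-read duality whose Weil values on a finite subgroup are `1` is TRIVIAL there.**  `w : Ĝ ≅ G^D` reads as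
Weil characters on finite points (`hread`, = `cartierPairing_theFamily_eq_weilChar` at `w := theFamily …`); `Ψ` finite affine, `xΨ : Ψ → G`, `ℓ : G → Ĝ`,
`φ : 𝒦 → G` a homomorphism from a finite commutative `𝒦`: if `e_q((y ≫ φ) ≫ j, ((t ≫ xΨ) ≫ ℓ) ≫ ĵ) = 1` for all finite points `t` of `Ψ`, `y` of `𝒦`, then
`((xΨ ≫ ℓ) ≫ w) ≫ φ^D = 1`.  (Test against the tautological point of `𝒦` over `Γ(Ψ) ⊗ Γ(𝒦)`, ★ `eq_of_cartierPairing_tautPt_eq` + ★ `isoSpecOver`; move `φ^D`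
across, ★ `cartierPairing_comp_cartierDualMap`; read; apply `hiso`.) [cite: MumfordAV1970, §20 (pp. 184–186)] [cite: Tate1997FiniteFlatGroupSchemes, §(3.8) p. 145] -/
theorem comp_comp_cartierDualMap_eq_one_of_weilChar
    (hD : Nonempty ((Scheme.Modules.pullback D.unitHatSlice).obj D.P ≅ SheafOfModules.unit _)) (w : Ĝ ≅ cartierDual G)
    (hread : ∀ ⦃T : Type u⦄ [CommRing T] [Algebra k T] [Module.Finite k T] (y : specOver k T ⟶ Ĝ) (x : specOver k T ⟶ G),
      cartierPairing G (y ≫ w.hom) x =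
        D.weilChar hD (p ^ r) (y ≫ ĵ) (Literature.AlgebraicGeometry.AbelianSchemes.WeilPairing.comp_pow_eq_one' (p ^ r) A D Ĝ ĵ hĜ y) (x ≫ j)
          (Literature.AlgebraicGeometry.AbelianSchemes.WeilPairing.comp_pow_eq_one (p ^ r) A G j hG x))
    (ℓ : G ⟶ Ĝ) (Ψ : SchemeOver k) [IsAffine Ψ.left] [Module.Finite k (Alg Ψ)] (xΨ : Ψ ⟶ G)
    (𝒦 : SchemeOver k) [GrpObj 𝒦] [IsCommMonObj 𝒦] [IsAffine 𝒦.left] [Module.Free k (Alg 𝒦)] [Module.Finite k (Alg 𝒦)]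
    (φ : 𝒦 ⟶ G) [IsMonHom φ]
    (hiso : ∀ ⦃T : Type u⦄ [CommRing T] [Algebra k T] [Module.Finite k T] (t : specOver k T ⟶ Ψ) (y : specOver k T ⟶ 𝒦),
      D.weilChar hD (p ^ r) (((t ≫ xΨ) ≫ ℓ) ≫ ĵ) (Literature.AlgebraicGeometry.AbelianSchemes.WeilPairing.comp_pow_eq_one' (p ^ r) A D Ĝ ĵ hĜ ((t ≫ xΨ) ≫ ℓ))
        ((y ≫ φ) ≫ j) (Literature.AlgebraicGeometry.AbelianSchemes.WeilPairing.comp_pow_eq_one (p ^ r) A G j hG (y ≫ φ)) = 1) :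
    ((xΨ ≫ ℓ) ≫ w.hom) ≫ cartierDualMap φ = 1 := by
  -- test over `S := Γ(Ψ)`: `(isoSpecOver Ψ).inv : Spec Γ(Ψ) ≅ Ψ` is an epimorphism
  rw [← cancel_epi (isoSpecOver Ψ).inv, MonObj.comp_one]
  -- a point of `𝒦^D` over `S` is `1` iff its pairing with the tautological point over `S ⊗ Γ(𝒦)` is `1`
  refine eq_of_cartierPairing_tautPt_eq 𝒦 ?_
  rw [MonObj.comp_one, cartierPairing_one_left]
  set t : specOver k (TensorProduct k (Alg Ψ) (Alg 𝒦)) ⟶ Ψ :=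
    AlgPoints.specOverMapOfAlgHom (Algebra.TensorProduct.includeLeft : Alg Ψ →ₐ[k] TensorProduct k (Alg Ψ) (Alg 𝒦)) ≫ (isoSpecOver Ψ).inv with ht
  have h1 : AlgPoints.specOverMapOfAlgHom (Algebra.TensorProduct.includeLeft : Alg Ψ →ₐ[k] TensorProduct k (Alg Ψ) (Alg 𝒦)) ≫
      ((isoSpecOver Ψ).inv ≫ (((xΨ ≫ ℓ) ≫ w.hom) ≫ cartierDualMap φ)) = (((t ≫ xΨ) ≫ ℓ) ≫ w.hom) ≫ cartierDualMap φ := by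
    simp only [ht, Category.assoc]
  rw [h1, cartierPairing_comp_cartierDualMap, hread]
  exact hiso t (tautPt 𝒦 (Alg Ψ))

omit [PerfectField k] in
/-- **THE DICTIONARY AT `e₀` (ED. 4), `λ`-form** — the (I-iso) socket of the W-DOCK organ `hKW_of_isotropy_of_finrank` in Weil currency: for `Ψ` finite affine,
`xΨ : Ψ → G`, `φ : 𝒦 → G` a homomorphism from a finite commutative `𝒦`, if the Weil characters `e_q((y ≫ φ) ≫ j, λ((t ≫ xΨ) ≫ j)) = 1` for all finite points
`t` of `Ψ`, `y` of `𝒦` (ANY torsion witness `h`), then `(xΨ ≫ e₀) ≫ φ^D = 1` (`e₀ = ℓ ≫ w_A`, `ℓ ≫ ĵ = j ≫ λ`, the reading `cartierPairing_theFamily_eq_weilChar`).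
At `xΨ := ψ ≫ jW`, `φ := κ ≫ j𝒢` this is «`((ψ ≫ jW) ≫ e₀) ≫ (κ ≫ j𝒢)^D = 1`». [cite: MumfordAV1970, §20 (pp. 184–186), §23 Thm. 2 (p. 231)] -/
theorem comp_e₀_comp_cartierDualMap_eq_one_of_weilChar
    (hD : Nonempty ((Scheme.Modules.pullback D.unitHatSlice).obj D.P ≅ SheafOfModules.unit _))
    (hlam : ∀ ⦃T : SchemeOver k⦄ (t : T ⟶ G), (t ≫ j) ≫ pol.lam = 1 → t = 1)
    (Ψ : SchemeOver k) [IsAffine Ψ.left] [Module.Finite k (Alg Ψ)] (xΨ : Ψ ⟶ G)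
    (𝒦 : SchemeOver k) [GrpObj 𝒦] [IsCommMonObj 𝒦] [IsAffine 𝒦.left] [Module.Free k (Alg 𝒦)] [Module.Finite k (Alg 𝒦)]
    (φ : 𝒦 ⟶ G) [IsMonHom φ]
    (hiso : ∀ ⦃T : Type u⦄ [CommRing T] [Algebra k T] [Module.Finite k T] (t : specOver k T ⟶ Ψ) (y : specOver k T ⟶ 𝒦)
      (h : (((t ≫ xΨ) ≫ j) ≫ pol.lam) ^ (p ^ r) = 1),
      D.weilChar hD (p ^ r) (((t ≫ xΨ) ≫ j) ≫ pol.lam) h ((y ≫ φ) ≫ j)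
        (Literature.AlgebraicGeometry.AbelianSchemes.WeilPairing.comp_pow_eq_one (p ^ r) A G j hG (y ≫ φ)) = 1) :
    (xΨ ≫ (e₀ p r A D pol j hG ĵ hĜ hlam).hom) ≫ cartierDualMap φ = 1 := by
  rw [e₀_hom_eq, ← Category.assoc xΨ]
  refine comp_comp_cartierDualMap_eq_one_of_weilChar p r A D j hG ĵ hĜ hD (theFamily p r A D G j hG Ĝ ĵ hĜ)
    (cartierPairing_theFamily_eq_weilChar p r A D hD G j hG Ĝ ĵ hĜ) (liftLam p r A D pol j hG ĵ hĜ) Ψ xΨ 𝒦 φ fun T _ _ _ t y => ?_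
  have hℓ : ((t ≫ xΨ) ≫ liftLam p r A D pol j hG ĵ hĜ) ≫ ĵ = ((t ≫ xΨ) ≫ j) ≫ pol.lam := by
    simp only [Category.assoc, liftLam_comp]
  rw [DualPair.weilChar_congr D hD (p ^ r) hℓ _ (hℓ ▸ Literature.AlgebraicGeometry.AbelianSchemes.WeilPairing.comp_pow_eq_one' (p ^ r) A D Ĝ ĵ hĜ _)
    rfl _ (Literature.AlgebraicGeometry.AbelianSchemes.WeilPairing.comp_pow_eq_one (p ^ r) A G j hG (y ≫ φ))]
  exact hiso t y _

omit [PerfectField k] in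
/-- `e₀` is a homomorphism. [cite: MumfordAV1970, §20 (I) (p. 189)] -/
theorem isMonHom_e₀_hom
    (hlam : ∀ ⦃T : SchemeOver k⦄ (t : T ⟶ G), (t ≫ j) ≫ pol.lam = 1 → t = 1) :
    IsMonHom (e₀ p r A D pol j hG ĵ hĜ hlam).hom := by
  rw [e₀_hom_eq]
  haveI := isMonHom_lift pol (liftLam p r A D pol j hG ĵ hĜ) (liftLam_comp p r A D pol j hG ĵ hĜ)
  haveI := (theFamily_isNatural p r).1 A D G j hG Ĝ ĵ hĜ
  infer_instance

omit [PerfectField k] in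
/-- `e₀` is HERMITIAN for every `(O, star, act, β)` satisfying the Rosati adjunction (★ `hermitian_of_natural` + naturality of the family in
endomorphisms). [cite: MumfordAV1970, §20 (I) (p. 189)] -/
theorem e₀_hermitian
    (hD : Nonempty ((Scheme.Modules.pullback D.unitHatSlice).obj D.P ≅ SheafOfModules.unit _))
    (hlam : ∀ ⦃T : SchemeOver k⦄ (t : T ⟶ G), (t ≫ j) ≫ pol.lam = 1 → t = 1)
    (O : Type) (star : O → O) (act : O → (A ⟶ A)) (β : O → (G ⟶ G)) [∀ a, IsMonHom (β a)]
    (hβ : ∀ a, β a ≫ j = j ≫ (act a).hom.hom.hom)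
    (hRos : ∀ a, (act (star a)).hom.hom.hom ≫ pol.lam =
      pol.lam ≫ dualIsogenyOver (A' := (AbelianScheme.ofAbelianVariety A).toOver) (B := (AbelianScheme.ofAbelianVariety A).toOver)
        (act a).hom.hom.hom D D) (a : O) :
    β (star a) ≫ (e₀ p r A D pol j hG ĵ hĜ hlam).hom = (e₀ p r A D pol j hG ĵ hĜ hlam).hom ≫ cartierDualMap (β a) := by
  rw [e₀_hom_eq]
  exact hermitian_of_natural p r A D hD pol hĜ (liftLam p r A D pol j hG ĵ hĜ) (liftLam_comp p r A D pol j hG ĵ hĜ) star act β hβ hRos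
    (theFamily p r A D G j hG Ĝ ĵ hĜ)
    (fun f β' _ hβ' βd hβd => (theFamily_isNatural p r).2 A A D D hD hD f G j hG Ĝ ĵ hĜ G j hG Ĝ ĵ hĜ β' hβ' βd hβd) a

/-- `A[F_q]` IS ITS OWN `e₀`-ANNIHILATOR (★ `lagrangian_of_frobeniusAnnihilates` + (W2) at the family). [cite: Oda1969, Cor. 1.3] -/
theorem e₀_lagrangian
    (hD : Nonempty ((Scheme.Modules.pullback D.unitHatSlice).obj D.P ≅ SheafOfModules.unit _))
    (hlam : ∀ ⦃T : SchemeOver k⦄ (t : T ⟶ G), (t ≫ j) ≫ pol.lam = 1 → t = 1)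
    {Φ : SchemeOver k} [GrpObj Φ] [IsCommMonObj Φ] [IsAffine Φ.left] [Module.Free k (Alg Φ)] [Module.Finite k (Alg Φ)]
    (φ : Φ ⟶ G) [IsMonHom φ] [IsClosedImmersion φ.left]
    (hΦ : ∀ ⦃T : SchemeOver k⦄ (t : T ⟶ G), (∃ s : T ⟶ Φ, s ≫ φ = t) ↔ (t ≫ j) ≫ (A.relFrobenius p r).hom.hom.hom = 1)
    ⦃T : SchemeOver k⦄ (x : T ⟶ G) :
    (∃ c : T ⟶ annihilator φ, c ≫ (annihilatorι φ ≫ (e₀ p r A D pol j hG ĵ hĜ hlam).inv) = x) ↔ ∃ s : T ⟶ Φ, s ≫ φ = x := by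
  haveI := isIso_lift pol hlam (liftLam p r A D pol j hG ĵ hĜ) (liftLam_comp p r A D pol j hG ĵ hĜ) (theFamily p r A D G j hG Ĝ ĵ hĜ)
  exact lagrangian_of_frobeniusAnnihilates p r A D pol j hlam ĵ (liftLam p r A D pol j hG ĵ hĜ) (liftLam_comp p r A D pol j hG ĵ hĜ) φ hΦ
    (theFamily p r A D G j hG Ĝ ĵ hĜ)
    (fun Φ' _ _ _ _ _ φ' _ _ hΦ' => theFamily_frobeniusAnnihilates p r A D hD G j hG Ĝ ĵ hĜ Φ φ hΦ Φ' φ' hΦ') x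

/-- **THE HEAD AT THE NAMED `e₀`**: the three hypotheses `(e₀, hherm₀, hlag₀)` of (BLF) hold for the TERM `e₀ p r A D pol j hG ĵ hĜ hlam`
(any realisation `Ĝ` of `Â[q]`). [cite: MumfordAV1970, §20 (I) (p. 189), §23] [cite: Oda1969, Cor. 1.3] -/
theorem weilCartierDualityLagrangian_at
    (hD : Nonempty ((Scheme.Modules.pullback D.unitHatSlice).obj D.P ≅ SheafOfModules.unit _))
    (hlam : ∀ ⦃T : SchemeOver k⦄ (t : T ⟶ G), (t ≫ j) ≫ pol.lam = 1 → t = 1)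
    {Φ : SchemeOver k} [GrpObj Φ] [IsCommMonObj Φ] [IsAffine Φ.left] [Module.Free k (Alg Φ)] [Module.Finite k (Alg Φ)]
    (φ : Φ ⟶ G) [IsMonHom φ] [IsClosedImmersion φ.left]
    (hΦ : ∀ ⦃T : SchemeOver k⦄ (t : T ⟶ G), (∃ s : T ⟶ Φ, s ≫ φ = t) ↔ (t ≫ j) ≫ (A.relFrobenius p r).hom.hom.hom = 1)
    (O : Type) (star : O → O) (act : O → (A ⟶ A)) (β : O → (G ⟶ G)) [∀ a, IsMonHom (β a)]
    (hβ : ∀ a, β a ≫ j = j ≫ (act a).hom.hom.hom)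
    (hRos : ∀ a, (act (star a)).hom.hom.hom ≫ pol.lam =
      pol.lam ≫ dualIsogenyOver (A' := (AbelianScheme.ofAbelianVariety A).toOver) (B := (AbelianScheme.ofAbelianVariety A).toOver)
        (act a).hom.hom.hom D D) :
    IsMonHom (e₀ p r A D pol j hG ĵ hĜ hlam).hom ∧
      (∀ a : O, β (star a) ≫ (e₀ p r A D pol j hG ĵ hĜ hlam).hom =
        (e₀ p r A D pol j hG ĵ hĜ hlam).hom ≫ cartierDualMap (β a)) ∧
      ∀ ⦃T : SchemeOver k⦄ (x : T ⟶ G),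
        (∃ c : T ⟶ annihilator φ, c ≫ (annihilatorι φ ≫ (e₀ p r A D pol j hG ĵ hĜ hlam).inv) = x) ↔ ∃ s : T ⟶ Φ, s ≫ φ = x :=
  ⟨isMonHom_e₀_hom p r A D pol j hG ĵ hĜ hlam, e₀_hermitian p r A D pol j hG ĵ hĜ hD hlam O star act β hβ hRos,
    e₀_lagrangian p r A D pol j hG ĵ hĜ hD hlam φ hΦ⟩

end Named

/-! ## §6 (P1′) THE (iso) LAW AT `e₀` — «KERNELS ARE ISOTROPIC AGAINST DUAL IMAGES» (a CLOSED theorem of naturality; the §2-form of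
F0P6b-plan (g3) 21:14Z; scheme-level twin of ★ `WeilUnitKernelOrthogonal` §2) -/

/-- For a NATURAL family `w`, a homomorphism `f : A → B` (normalised dual pairs), lifts `β` of `f` and `βd` of `f^∨` to the `q`-torsion
realisations, ANY layer map `ℓ : G_A → Ĝ_A`, and a closed subgroup `φK : K ↪ G_A` killed by `β` whose `ℓ`-image lies in the `βd`-image of `Ĝ_B`
(one layer map `g` with `g ≫ βd = φK ≫ ℓ`): `(φK ≫ ℓ ≫ w_A) ≫ φK^D = 1`. [cite: MumfordAV1970, §20 p. 186, §23] -/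
theorem WeilFamily.comp_comp_cartierDualMap_eq_one_of_isNatural {k : Type u} [Field k] {p : ℕ} [ExpChar k p] {r : ℕ}
    (w : WeilFamily k p r) (hw : w.IsNatural)
    (A B : AbelianVariety k) (DA : (AbelianScheme.ofAbelianVariety A).toOver.DualPair)
    (DB : (AbelianScheme.ofAbelianVariety B).toOver.DualPair)
    (hDA : Nonempty ((Scheme.Modules.pullback DA.unitHatSlice).obj DA.P ≅ SheafOfModules.unit _))
    (hDB : Nonempty ((Scheme.Modules.pullback DB.unitHatSlice).obj DB.P ≅ SheafOfModules.unit _)) (f : A ⟶ B)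
    (GA : SchemeOver k) [GrpObj GA] [IsCommMonObj GA] [IsAffine GA.left] [Module.Free k (Alg GA)] [Module.Finite k (Alg GA)]
    (jA : GA ⟶ A.X) [IsMonHom jA] [IsClosedImmersion jA.left]
    (hGA : ∀ ⦃T : SchemeOver k⦄ (t : T ⟶ A.X), (∃ s : T ⟶ GA, s ≫ jA = t) ↔ t ≫ ((((p ^ r : ℕ) : ℤ) • 𝟙 A).hom.hom.hom) = 1)
    (ĜA : SchemeOver k) [GrpObj ĜA] [IsCommMonObj ĜA] [IsAffine ĜA.left] [Module.Free k (Alg ĜA)] [Module.Finite k (Alg ĜA)]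
    (ĵA : ĜA ⟶ DA.hat.X) [IsMonHom ĵA] [IsClosedImmersion ĵA.left]
    (hĜA : ∀ ⦃T : SchemeOver k⦄ (t : T ⟶ DA.hat.X),
      (∃ s : T ⟶ ĜA, s ≫ ĵA = t) ↔ t ≫ ((((p ^ r : ℕ) : ℤ) • 𝟙 DA.hat.toAffine.toAbelianVariety).hom.hom.hom) = 1)
    (GB : SchemeOver k) [GrpObj GB] [IsCommMonObj GB] [IsAffine GB.left] [Module.Free k (Alg GB)] [Module.Finite k (Alg GB)]
    (jB : GB ⟶ B.X) [IsMonHom jB] [IsClosedImmersion jB.left]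
    (hGB : ∀ ⦃T : SchemeOver k⦄ (t : T ⟶ B.X), (∃ s : T ⟶ GB, s ≫ jB = t) ↔ t ≫ ((((p ^ r : ℕ) : ℤ) • 𝟙 B).hom.hom.hom) = 1)
    (ĜB : SchemeOver k) [GrpObj ĜB] [IsCommMonObj ĜB] [IsAffine ĜB.left] [Module.Free k (Alg ĜB)] [Module.Finite k (Alg ĜB)]
    (ĵB : ĜB ⟶ DB.hat.X) [IsMonHom ĵB] [IsClosedImmersion ĵB.left]
    (hĜB : ∀ ⦃T : SchemeOver k⦄ (t : T ⟶ DB.hat.X),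
      (∃ s : T ⟶ ĜB, s ≫ ĵB = t) ↔ t ≫ ((((p ^ r : ℕ) : ℤ) • 𝟙 DB.hat.toAffine.toAbelianVariety).hom.hom.hom) = 1)
    (β : GA ⟶ GB) [IsMonHom β] (hβ : β ≫ jB = jA ≫ f.hom.hom.hom)
    (βd : ĜB ⟶ ĜA)
    (hβd : βd ≫ ĵA = ĵB ≫ dualIsogenyOver (A' := (AbelianScheme.ofAbelianVariety A).toOver)
      (B := (AbelianScheme.ofAbelianVariety B).toOver) f.hom.hom.hom DA DB)
    (ℓ : GA ⟶ ĜA)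
    {K : SchemeOver k} [GrpObj K] [IsCommMonObj K] [IsAffine K.left] [Module.Free k (Alg K)] [Module.Finite k (Alg K)]
    (φK : K ⟶ GA) [IsMonHom φK] (hK : φK ≫ β = 1)
    (g : K ⟶ ĜB) (hg : g ≫ βd = φK ≫ ℓ) :
    (φK ≫ ℓ ≫ (w A DA GA jA hGA ĜA ĵA hĜA).hom) ≫ cartierDualMap φK = 1 := by
  have hnat := hw.2 A B DA DB hDA hDB f GA jA hGA ĜA ĵA hĜA GB jB hGB ĜB ĵB hĜB β hβ βd hβd
  calc (φK ≫ ℓ ≫ (w A DA GA jA hGA ĜA ĵA hĜA).hom) ≫ cartierDualMap φK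
      = g ≫ (βd ≫ (w A DA GA jA hGA ĜA ĵA hĜA).hom) ≫ cartierDualMap φK := by
          simp only [← Category.assoc, ← hg]
    _ = g ≫ (w B DB GB jB hGB ĜB ĵB hĜB).hom ≫ (cartierDualMap β ≫ cartierDualMap φK) := by
          simp only [hnat, Category.assoc]
    _ = g ≫ (w B DB GB jB hGB ĜB ĵB hĜB).hom ≫ cartierDualMap (φK ≫ β) := by rw [cartierDualMap_comp]
    _ = 1 := by rw [cartierDualMap_of_eq_one (φK ≫ β) hK, MonObj.comp_one, MonObj.comp_one]

/-- **(iso) «POLARISED-ISOGENY KERNELS ARE `e₀`-ISOTROPIC» (letter, CLOSED below).**  For: `A`, `B` with dual pairs of the right dimensions and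
normalised Poincaré sheaves, `f : A → B`, a polarization `λ` of `A`, realisations of `A[q]` (`GA`, with `hlam`), `Â[q]` (`ĜA`), `B[q]` (`GB`),
`B̂[q]` (`ĜB`), lifts `β` of `f` and `βd` of `f^∨`, and a closed subgroup `φK : K ↪ A[q]` KILLED by `β` («`K ⊆ Ker f ∩ A[q]`») whose image under
the lift `ℓ` of `λ|_{A[q]}` lies in `βd(B̂[q])` («`λ(K) ⊆ f^∨(B̂[q])`», ONE layer map `g` with `g ≫ βd = φK ≫ ℓ`): every `T`-point of `K` maps
under THE NAMED DUALITY `e₀` into the annihilator `K^⊥ ⊂ A[q]^D` — `K` is `e₀`-ISOTROPIC.  (The unconditional form — `Ker f ∩ A[q]` isotropic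
whenever `f ≫ λ_B ≫ f^∨ = λ ≫ [p]` — is Mumford §23 Thm. 2 descent and is NOT claimed here.) (print: MumfordAV1970, §20 p. 186, §23) -/
def PolarisedIsogenyKernelIsotropic : Prop :=
  ∀ ⦃k : Type u⦄ [Field k] [PerfectField k] (p : ℕ) [Fact p.Prime] [CharP k p] (r : ℕ) (A B : AbelianVariety k)
    (DA : (AbelianScheme.ofAbelianVariety A).toOver.DualPair) (DB : (AbelianScheme.ofAbelianVariety B).toOver.DualPair)
    (_hDA : Nonempty ((Scheme.Modules.pullback DA.unitHatSlice).obj DA.P ≅ SheafOfModules.unit _))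
    (_hDB : Nonempty ((Scheme.Modules.pullback DB.unitHatSlice).obj DB.P ≅ SheafOfModules.unit _)) (f : A ⟶ B)
    (polA : (AbelianScheme.ofAbelianVariety A).toOver.Polarization DA)
    (GA : SchemeOver k) [GrpObj GA] [IsCommMonObj GA] [IsAffine GA.left] [Module.Free k (Alg GA)] [Module.Finite k (Alg GA)]
    (jA : GA ⟶ A.X) [IsMonHom jA] [IsClosedImmersion jA.left]
    (hGA : ∀ ⦃T : SchemeOver k⦄ (t : T ⟶ A.X), (∃ s : T ⟶ GA, s ≫ jA = t) ↔ t ≫ ((((p ^ r : ℕ) : ℤ) • 𝟙 A).hom.hom.hom) = 1)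
    (hlam : ∀ ⦃T : SchemeOver k⦄ (t : T ⟶ GA), (t ≫ jA) ≫ polA.lam = 1 → t = 1)
    (ĜA : SchemeOver k) [GrpObj ĜA] [IsCommMonObj ĜA] [IsAffine ĜA.left] [Module.Free k (Alg ĜA)] [Module.Finite k (Alg ĜA)]
    (ĵA : ĜA ⟶ DA.hat.X) [IsMonHom ĵA] [IsClosedImmersion ĵA.left]
    (hĜA : ∀ ⦃T : SchemeOver k⦄ (t : T ⟶ DA.hat.X),
      (∃ s : T ⟶ ĜA, s ≫ ĵA = t) ↔ t ≫ ((((p ^ r : ℕ) : ℤ) • 𝟙 DA.hat.toAffine.toAbelianVariety).hom.hom.hom) = 1)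
    (GB : SchemeOver k) [GrpObj GB] [IsCommMonObj GB] [IsAffine GB.left] [Module.Free k (Alg GB)] [Module.Finite k (Alg GB)]
    (jB : GB ⟶ B.X) [IsMonHom jB] [IsClosedImmersion jB.left]
    (_hGB : ∀ ⦃T : SchemeOver k⦄ (t : T ⟶ B.X), (∃ s : T ⟶ GB, s ≫ jB = t) ↔ t ≫ ((((p ^ r : ℕ) : ℤ) • 𝟙 B).hom.hom.hom) = 1)
    (ĜB : SchemeOver k) [GrpObj ĜB] [IsCommMonObj ĜB] [IsAffine ĜB.left] [Module.Free k (Alg ĜB)] [Module.Finite k (Alg ĜB)]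
    (ĵB : ĜB ⟶ DB.hat.X) [IsMonHom ĵB] [IsClosedImmersion ĵB.left]
    (_hĜB : ∀ ⦃T : SchemeOver k⦄ (t : T ⟶ DB.hat.X),
      (∃ s : T ⟶ ĜB, s ≫ ĵB = t) ↔ t ≫ ((((p ^ r : ℕ) : ℤ) • 𝟙 DB.hat.toAffine.toAbelianVariety).hom.hom.hom) = 1)
    (β : GA ⟶ GB) [IsMonHom β] (_hβ : β ≫ jB = jA ≫ f.hom.hom.hom)
    (βd : ĜB ⟶ ĜA)
    (_hβd : βd ≫ ĵA = ĵB ≫ dualIsogenyOver (A' := (AbelianScheme.ofAbelianVariety A).toOver)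
      (B := (AbelianScheme.ofAbelianVariety B).toOver) f.hom.hom.hom DA DB)
    (K : SchemeOver k) [GrpObj K] [IsCommMonObj K] [IsAffine K.left] [Module.Free k (Alg K)] [Module.Finite k (Alg K)]
    (φK : K ⟶ GA) [IsMonHom φK] [IsClosedImmersion φK.left] (_hK : φK ≫ β = 1)
    (g : K ⟶ ĜB) (_hg : g ≫ βd = φK ≫ liftLam p r A DA polA jA hGA ĵA hĜA),
    ∀ ⦃T : SchemeOver k⦄ (x : T ⟶ K),
      ∃ c : T ⟶ annihilator φK, c ≫ annihilatorι φK = (x ≫ φK) ≫ (e₀ p r A DA polA jA hGA ĵA hĜA hlam).hom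

/-- **(iso) HOLDS — CLOSED, no socket**: naturality square of the (W1) family + `(φK ≫ β)^D = 1^D = 1`. [cite: MumfordAV1970, §20 p. 186, §23] -/
theorem polarisedIsogenyKernelIsotropic_holds : PolarisedIsogenyKernelIsotropic.{u} := by
  intro k _ _ p _ _ r A B DA DB hDA hDB f polA GA _ _ _ _ _ jA _ _ hGA hlam ĜA _ _ _ _ _ ĵA _ _ hĜA
    GB _ _ _ _ _ jB _ _ hGB ĜB _ _ _ _ _ ĵB _ _ hĜB β _ hβ βd hβd K _ _ _ _ _ φK _ _ hK g hg T x
  rw [exists_eq_comp_annihilatorι_iff, ← comp_cartierDualMap_eq_one_iff, e₀_hom_eq, Category.assoc, Category.assoc,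
    ← Category.assoc φK,
    (theFamily p r).comp_comp_cartierDualMap_eq_one_of_isNatural (theFamily_isNatural p r) A B DA DB hDA hDB f GA jA hGA
      ĜA ĵA hĜA GB jB hGB ĜB ĵB hĜB β hβ βd hβd (liftLam p r A DA polA jA hGA ĵA hĜA) φK hK g hg,
    MonObj.comp_one]

end Summit.HodgeConjecture.HodgeConjecture.Cruxes.HLiu418.F0P6bWeilCartierDuality

end
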